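import Mathlib
import Literature.Geometry.Lorentzian.FinalEraPackage2
import Literature.Geometry.Lorentzian.TameGenericityDiagonal
import Summits.FinalStateConjecture.FinalStateConjecture.Theses.DissipativeFinalMotions
import Summits.FinalStateConjecture.FinalStateConjecture.Theorems.DissipativeFinalMotionsDispersalFromBudget
import HarnessLib

/-!
# Route DissipativeFinalMotions — the budget-free assembly: `RadiativeLyapunovBudget` can be retired
# into the pre-phase (`--supports` stmt-FinalStateConjecture-10993)

The deciding theorem of the route `DissipativeFinalMotions` (summit `FinalStateConjecture`) is
`closes : FinalEraGeneric → RadiativeLyapunovBudget → DispersingCapture → FinalStateConjecture`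
(route file rev 4; the proved support `DispersalFromBudget` is replayed inline). Its rank-2 crux
`RadiativeLyapunovBudget` (RLB) is, by the landed structure theorem
`radiativeLyapunovBudget_iff_packageDisperses` (p148537), EXACTLY the statement that for EVERY
admissible datum, EVERY maximal development with complete `𝓘⁺` and EVERY rev-2 final-era package
the labels pairwise disperse — "no eternal certified binary", open-problem class, and two lines on it
are dead (`Cruxes/RadiativeLyapunovBudget/Lines/*dead.md`: the Bondi ledger needs round cone-section
families no development in tree can construct, the loitering floor is the crux itself).

This file records, sorry-free and GR-free, the ROUTE-LEVEL consequence: the summit needs dispersal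
only TAME-GENERICALLY and only for SOME oriented package, i.e. RLB is over-strong for `closes`, and
the budget (with the support `DispersalFromBudget`) can be folded into the pre-phase crux at zero
cost. Write `FinalEraGeneric₊` for `FinalEraGeneric` with ONE more conjunct inside its `∃`-package,
the dispersal clause `∀ i j, i ≠ j → Tendsto (fun t ↦ ‖ξ i t - ξ j t‖) atTop atTop` (verbatim the
last hypothesis of `DispersingCapture`); it is stated INLINE below (no new definition). Then

* `dispersingEra_of_budget` — `FinalEraGeneric → RadiativeLyapunovBudget → FinalEraGeneric₊`:
  the strengthened pre-phase is implied by the current pair of cruxes (pointwise on an admissible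
  datum and a maximal development, the package of `FinalEraGeneric` is fed to RLB, and the budget with
  the package's Lipschitz clause, conjunct 14, to the landed `DispersalFromBudget_proof`; tame
  genericity is monotone, `IsTameChristodoulouGeneric.mono`), so the repaired route is AT LEAST AS
  PROVABLE as the filed one;
* `closes_of_dispersingEra` — `FinalEraGeneric₊ → DispersingCapture → FinalStateConjecture`: the
  strengthened pre-phase and the capture crux alone close the summit (the body of `closes` with the
  budget step deleted), so the repaired route STILL CLOSES the Statement;
* `closes_of_budget` — sanity: composing the two gives back the shape of the route's `closes`.

Hence the planner may restate the route as {`FinalEraGeneric₊`, `DispersingCapture`} (two cruxes,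
both already filed as XL / open-problem class) and drop `RadiativeLyapunovBudget` and
`DispersalFromBudget` from `closes`; the physics "generic data do not end in an eternal binary" then
sits where the other final-motion physics of the route already sits (the pre-phase), for GENERIC data
and ONE package, instead of being demanded of all admissible data and all packages. Nothing here bears
on the truth of either crux. Marchal–Saari, J. Differential Equations 20 (1976) 150, for the dispersal
vocabulary ("final evolutions"); Dafermos–Luk arXiv:1710.01722, p. 8, for the target picture.
-/

-- the doubled `FinalStateConjecture.FinalStateConjecture` path component trips dupNamespace
set_option linter.dupNamespace false

noncomputable section

open scoped Manifold ContDiff Topology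
open Filter Set Literature.Geometry.Lorentzian

namespace Summit.FinalStateConjecture.FinalStateConjecture.Theorems.DissipativeFinalMotions

open Summit.FinalStateConjecture.FinalStateConjecture.Theses.DissipativeFinalMotions
  (FinalEraGeneric RadiativeLyapunovBudget DispersingCapture)

/-- **The strengthened pre-phase follows from the filed pair of cruxes**:
`FinalEraGeneric → RadiativeLyapunovBudget → FinalEraGeneric₊`, where `FinalEraGeneric₊` (inline) is
`FinalEraGeneric` with the dispersal clause `∀ i ≠ j, ‖ξᵢ t − ξⱼ t‖ → ∞` added inside its
`∃`-package. Pointwise on an admissible datum and a maximal development: the rev-2 package of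
`FinalEraGeneric` (`IsFinalEra₂`, by `Iff.rfl` the inline hypothesis of the budget) is fed to the
budget, and the budget with the package's `V`-Lipschitz clause (conjunct 14) to the landed
`DispersalFromBudget_proof`; tame Christodoulou genericity is monotone under pointwise implication
(`IsTameChristodoulouGeneric.mono`). [folklore] -/
theorem dispersingEra_of_budget : open Literature.Geometry.Lorentzian Filter in open scoped Manifold ContDiff Topology in Summit.FinalStateConjecture.FinalStateConjecture.Theses.DissipativeFinalMotions.FinalEraGeneric → Summit.FinalStateConjecture.FinalStateConjecture.Theses.DissipativeFinalMotions.RadiativeLyapunovBudget → ∀ (X : Type) [TopologicalSpace X] [ChartedSpace E3 X] [IsManifold (𝓡 3) ∞ X] [T2Space X] [SecondCountableTopology X] [ConnectedSpace X], InitialDataSet.IsTameChristodoulouGeneric (admissibleVacuumData X) (fun D ↦ (∃ 𝒟 : VacuumCauchyDevelopment D, 𝒟.IsMaximal) ∧ ∀ 𝒟 : VacuumCauchyDevelopment D, 𝒟.IsMaximal → Summit.FinalStateConjecture.HasCompleteNullInfinity 𝒟.toCauchyDevelopment ∧ ∃ (N : ℕ) (M a : Fin N → ℝ) (T δ V C₁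 C₂ ρ₀ κ : ℝ) (ξ : Fin N → ℝ → E3) (β : ℝ → ℝ) (U₀ : TopologicalSpace.Opens E4) (B₀ : ModelBackground) (B : Fin N → ModelBackground) (Ψ₀ : B₀.domain → 𝒟.carrier) (Ψ : (i : Fin N) → (B i).domain → 𝒟.carrier) (O : Set 𝒟.carrier), 𝒟.toCauchyDevelopment.IsFinalEra₂ N M a T δ V C₁ C₂ ρ₀ κ ξ β U₀ B₀ B Ψ₀ Ψ O ∧ Summit.FinalStateConjecture.RaysStayInClosure 𝒟.toCauchyDevelopment O ∧ (∀ i (ρ : ℝ), ∀ᶠ τ in atTop, ∀ x ∈ (B i).truncTimeSlab ρ τ, 𝒟.toSpacetime.timeOrientation.IsFutureDirected (mfderiv 𝓘(ℝ, E4) (𝓡 4) (Ψ i) x (Kerr.timeVector (M i) (a i) x.1))) ∧ (∃ ϱ₀ : ℝ, ∀ᶠ τ in atTop, ∀ x ∈ B₀.timeSlab τ, (∀ i, ϱ₀ ≤ ‖E4.spatial x.1 - ξ i τ‖) → 𝒟.toSpacetime.timeOrientation.IsFutureDirected (mfderiv 𝓘(ℝ, E4) (𝓡 4) Ψ₀ x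 (E4.basisVector 0))) ∧ (∀ i j : Fin N, i ≠ j → Tendsto (fun t ↦ ‖ξ i t - ξ j t‖) atTop atTop)) 1 := by
  intro h₃ h₁ X _ _ _ _ _ _
  refine (h₃ X).mono fun D hD hQD ↦ ⟨hQD.1, fun 𝒟 hmax ↦ ?_⟩
  obtain ⟨hscri, N, M, a, T, δ, V, C₁, C₂, ρ₀, κ, ξ, β, U₀, B₀, B, Ψ₀, Ψ, O, hera, hrays, hholes,
    hflat⟩ := hQD.2 𝒟 hmax
  -- the 31-clause package `IsFinalEra₂` is by definition the inline hypothesis of the budget item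
  obtain ⟨E, hanti, hbdd, hcoer⟩ :=
    h₁ X D hD 𝒟 hmax hscri N M a T δ V C₁ C₂ ρ₀ κ ξ β U₀ B₀ B Ψ₀ Ψ O hera
  -- dispersal from the budget and the Lipschitz speed clause (conjunct 14 of the package)
  have hdisp : ∀ i j : Fin N, i ≠ j → Tendsto (fun t ↦ ‖ξ i t - ξ j t‖) atTop atTop :=
    DispersalFromBudget_proof N T V ξ E hera.2.2.2.2.2.2.2.2.2.2.2.2.2.1 hanti hbdd hcoer
  exact ⟨hscri, N, M, a, T, δ, V, C₁, C₂, ρ₀, κ, ξ, β, U₀, B₀, B, Ψ₀, Ψ, O, hera, hrays, hholes, hflat,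
    hdisp⟩

/-- **The budget-free assembly**: `FinalEraGeneric₊ → DispersingCapture → FinalStateConjecture`,
where `FinalEraGeneric₊` (inline) is `FinalEraGeneric` with the dispersal clause
`∀ i ≠ j, ‖ξᵢ t − ξⱼ t‖ → ∞` added inside its `∃`-package. This is the body of the route's deciding
theorem `closes` with the budget step deleted: tame Christodoulou genericity is monotone under
pointwise implication (`IsTameChristodoulouGeneric.mono`), and pointwise on an admissible datum and a
maximal development the dispersing, oriented rev-2 era (package `IsFinalEra₂` + (R), (F), (F₀) +
dispersal) is fed to `DispersingCapture`, whose conclusion is verbatim the re-typed Statement's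
clause. So the route restated as {`FinalEraGeneric₊`, `DispersingCapture`} still closes the summit,
without `RadiativeLyapunovBudget` and without `DispersalFromBudget`. [folklore] -/
theorem closes_of_dispersingEra : open Literature.Geometry.Lorentzian Filter in open scoped Manifold ContDiff Topology in (∀ (X : Type) [TopologicalSpace X] [ChartedSpace E3 X] [IsManifold (𝓡 3) ∞ X] [T2Space X] [SecondCountableTopology X] [ConnectedSpace X], InitialDataSet.IsTameChristodoulouGeneric (admissibleVacuumData X) (fun D ↦ (∃ 𝒟 : VacuumCauchyDevelopment D, 𝒟.IsMaximal) ∧ ∀ 𝒟 : VacuumCauchyDevelopment D, 𝒟.IsMaximal → Summit.FinalStateConjecture.HasCompleteNullInfinity 𝒟.toCauchyDevelopment ∧ ∃ (N : ℕ) (M a : Fin N → ℝ) (T δ V C₁ C₂ ρ₀ κ : ℝ) (ξ : Fin N → ℝ → E3) (β : ℝ → ℝ) (U₀ : TopologicalSpace.Opens E4) (B₀ : ModelBackground) (B : Fin N → ModelBackground) (Ψ₀ : B₀.domain → 𝒟.carrier) (Ψ : (i : Fin N) → (B i).domain → 𝒟.carrier) (O : Set 𝒟.carrier), 𝒟.toCauchyDevelopment.IsFinalEra₂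 N M a T δ V C₁ C₂ ρ₀ κ ξ β U₀ B₀ B Ψ₀ Ψ O ∧ Summit.FinalStateConjecture.RaysStayInClosure 𝒟.toCauchyDevelopment O ∧ (∀ i (ρ : ℝ), ∀ᶠ τ in atTop, ∀ x ∈ (B i).truncTimeSlab ρ τ, 𝒟.toSpacetime.timeOrientation.IsFutureDirected (mfderiv 𝓘(ℝ, E4) (𝓡 4) (Ψ i) x (Kerr.timeVector (M i) (a i) x.1))) ∧ (∃ ϱ₀ : ℝ, ∀ᶠ τ in atTop, ∀ x ∈ B₀.timeSlab τ, (∀ i, ϱ₀ ≤ ‖E4.spatial x.1 - ξ i τ‖) → 𝒟.toSpacetime.timeOrientation.IsFutureDirected (mfderiv 𝓘(ℝ, E4) (𝓡 4) Ψ₀ x (E4.basisVector 0))) ∧ (∀ i j : Fin N, i ≠ j → Tendsto (fun t ↦ ‖ξ i t - ξ j t‖) atTop atTop)) 1) → Summit.FinalStateConjecture.FinalStateConjecture.Theses.DissipativeFinalMotions.DispersingCapture → _root_.FinalStateConjecture := by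
  intro h₃' h₄ X _ _ _ _ _ _
  refine (h₃' X).mono fun D hD hQD ↦ ⟨hQD.1, fun 𝒟 hmax ↦ ?_⟩
  obtain ⟨hscri, N, M, a, T, δ, V, C₁, C₂, ρ₀, κ, ξ, β, U₀, B₀, B, Ψ₀, Ψ, O, hera, hrays, hholes,
    hflat, hdisp⟩ := hQD.2 𝒟 hmax
  -- capture of the dispersing, oriented era is verbatim the Statement's clause
  exact ⟨hscri, h₄ X D hD 𝒟 hmax hscri N M a T δ V C₁ C₂ ρ₀ κ ξ β U₀ B₀ B Ψ₀ Ψ O hera hrays hholes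
    hflat hdisp⟩

/-- **Sanity: the two pieces recompose the route's deciding theorem.** From `FinalEraGeneric`,
`RadiativeLyapunovBudget` and `DispersingCapture` the summit statement follows by
`closes_of_dispersingEra (dispersingEra_of_budget …)` — the same shape as the route's `closes`, so
the proposed restatement loses nothing. [folklore] -/
theorem closes_of_budget (h₃ : FinalEraGeneric) (h₁ : RadiativeLyapunovBudget)
    (h₄ : DispersingCapture) : _root_.FinalStateConjecture :=
  closes_of_dispersingEra (dispersingEra_of_budget h₃ h₁) h₄

end Summit.FinalStateConjecture.FinalStateConjecture.Theorems.DissipativeFinalMotions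

end
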